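import Summits.Ventures.HSemireg.WedgeWeilPuritySchur

/-!
# Venture HSemireg — W-PURITY in mirrored Schur form: b ≠ 0, every a (the one-sided case a = 0)

HONEST FRAMING. Part of the Lean index of the computation cell `pub-hsemireg` (second enclosure wave, cut by seat p6 in the
conventions of seat p3's ENCLOSURE-PLAN-p3.md / build.py from th-7's kernel assets).  Finite-dimensional exterior algebra over a field ONLY:
no variety, no cohomology theory, no semiregularity map is constructed here; nothing here says that HC / HC_CM / HC_AV holds;
no Literature fact is declared or used.  The geometric DICTIONARY (why these ranks are the `HT`-side box ranks of the cell's
STRUCTURE.md §1 / theory/FORMULA-N.md) lives in theory/FORMULA-N-th7.md PART B §A.3 / §N and is NOT asserted in Lean.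

th-7's PART S5 — THE MIRRORED SCHUR FORM OF THE ENDS BLOCK (theory/th7/WPurityStructure.lean v5 058a3041b767b211, PART S5 (= WPurityStructure.PartS5.lean 4ce4f6533f2ade3f; th-7 g7, 03:09Z 2026-08-23; ×2 th-3 g17 03:13Z (farm rc 0 + axioms standard + negative controls (H)(I) + statement read) and th-2 g23 03:13Z (farm + statement read + proof read); th-7's negative control «2ρ → 3ρ» rc 1), the block after PART S4's
`end Locus`), VERBATIM up to the namespace (`HSemiregWeil` ↦ `Summit.Ventures.HSemireg.Wedge.Weil`): Weil type `(n,n)`, `m = n ≥ 1`, **`b ≠ 0` and EVERY `a`** (in particular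
the ONE-SIDED case `a = 0`), every `q` (any `ρ = rank H_n(q)`), every field.  Swapping `E₋ ↔ E₊`, `ψ₊ ↔ ψ₋`, `a ↔ b` in `WedgeWeilPuritySchur.lean`: `JmapM = id − b⁻¹ψ₋`,
`schurOpM = ψ₊∘ψ₋ − (ab)·id`; **`ends_ker_eq_mirror (hn : 1 ≤ n) (q) (a) (hb : b ≠ 0)`**: `Em ⊓ ker(∧v) = J′(E₋ ⊓ ker(ψ₊ψ₋ − ab))`, `E₋ = Hom(Dm) n`; `finrank_ends_ker_mirror`;
**`weilPurity_schur_mirror (hn : 1 ≤ n) (q) (a) (hb : b ≠ 0)`**: `finrank range(wedge K (n+n) n (vW K (n+n) n q a b)) + 2ρ + finrank(Hom K (In (n+n)) (Dm (n+n) n) n ⊓ ker schurOpM)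
= C(2n,n)·ρ + (C(2n,n) + C(2n,n))`, i.e. rank = `C(2n,n)(2+ρ) − 2ρ − dim ker(ψ₊ψ₋ − ab ∣ E₋)`.  With `weilPurity_schur` (`a ≠ 0`, on `E₊`) EVERY `(a,b) ≠ (0,0)` has a kernel
Schur form ((0,0) is THEOREM H, rank `C(2n,n)·ρ`); at `a = 0`, `b ≠ 0`: rank `= C(2n,n)(1+ρ) − 2ρ + rank(ψ₊ψ₋ ∣ E₋)` — the kernel half of the one-sided law; the compression
`rank(ψ₊ψ₋ ∣ E₋) = rank(H_nΩ_nH_n)` stays DERIVED + exact (n ≤ 4), NOT in the kernel.  Imports `WedgeWeilPuritySchur.lean` only (PART S3/S4 are not used).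
-/

open Module Set Set.powersetCard Summit.Ventures.HSemireg.Wedge.Hankel

namespace Summit.Ventures.HSemireg.Wedge.Weil

variable (K : Type*) [Field K]

/-! ## PART S5 (th-7 g7, 2026-08-23) — THE MIRRORED SCHUR FORM (b ≠ 0): the one-sided case a = 0 enters the kernel
Swapping the roles of `E₋`/`E₊`: for `b ≠ 0`, `Ends ⊓ ker(∧v) = J′(E₋ ⊓ ker(ψ₊ψ₋ − ab))`, `J′ = id − b⁻¹ψ₋`, hence
`rank(∧v ∣ HTⁿ) = C(2n,n)(2+ρ) − 2ρ − dim ker(ψ₊ψ₋ − ab ∣ E₋)` for every `a` (including `a = 0`). Together with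
`weilPurity_schur` (a ≠ 0) every `(a,b) ≠ (0,0)` now has a kernel Schur form. -/

section SchurMirror

variable {n : ℕ}

variable (n) in
/-- `J′ := id − b⁻¹ψ₋`, the mirror of `Jmap` (injective on `E₋ = Hom(Dm) n`). -/
noncomputable def JmapM (q : ℕ → K) (b : K) : HT K (In (n + n)) →ₗ[K] HT K (In (n + n)) :=
  LinearMap.id - b⁻¹ • psiM K n q

variable (n) in
/-- the MIRRORED Schur operator `ψ₊ψ₋ − ab·id` (mirror of `schurOp`; used on `E₋ = Hom(Dm) n`). -/
noncomputable def schurOpM (q : ℕ → K) (a b : K) : HT K (In (n + n)) →ₗ[K] HT K (In (n + n)) :=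
  psiP K n q ∘ₗ psiM K n q - (a * b) • LinearMap.id

/-- unfolding of `J′ = id − b⁻¹ψ₋`. -/
lemma JmapM_apply (q : ℕ → K) (b : K) (θ : HT K (In (n + n))) :
    JmapM K n q b θ = θ - b⁻¹ • psiM K n q θ := by
  simp [JmapM]

/-- unfolding of the mirrored Schur operator `ψ₊ψ₋ − ab·id`. -/
lemma schurOpM_apply (q : ℕ → K) (a b : K) (θ : HT K (In (n + n))) :
    schurOpM K n q a b θ = psiP K n q (psiM K n q θ) - (a * b) • θ := by
  simp [schurOpM]

/-- **mirrored ends kernel:** for `b ≠ 0`, `Ends ⊓ ker(∧v) = J′(E₋ ⊓ ker(ψ₊ψ₋ − ab))`. -/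
theorem ends_ker_eq_mirror (hn : 1 ≤ n) (q : ℕ → K) (a : K) {b : K} (hb : b ≠ 0) :
    Em K (n + n) n n ⊓ LinearMap.ker (LinearMap.mulRight K (vW K (n + n) n q a b)) =
      (Hom K (In (n + n)) (Dm (n + n) n) n ⊓ LinearMap.ker (schurOpM K n q a b)).map (JmapM K n q b) := by
  apply le_antisymm
  · intro θ hθ0
    obtain ⟨hθ, h0⟩ := Submodule.mem_inf.mp hθ0
    rw [LinearMap.mem_ker, LinearMap.mulRight_apply] at h0
    obtain ⟨θm, hm, θp, hp, rfl⟩ := Em_decomp K hθ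
    rw [ends_mul_vW K hn q a b hm hp] at h0
    have hX : psiM K n q θm + b • θp ∈ Hom K (In (n + n)) (Gm (n + n) n) n :=
      Submodule.add_mem _ (psiM_mem K q hm) (Submodule.smul_mem _ _ hp)
    have hY : a • θm + psiP K n q θp ∈ Hom K (In (n + n)) (Dm (n + n) n) n :=
      Submodule.add_mem _ (Submodule.smul_mem _ _ hm) (psiP_mem K q hp)
    obtain ⟨hX0, hY0⟩ := ends_separation K hn hX hY h0
    -- θp = −b⁻¹ ψ₋ θm
    have hθp : θp = -(b⁻¹ • psiM K n q θm) := by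
      have h1 : b • θp = -(psiM K n q θm) := eq_neg_of_add_eq_zero_right hX0
      have h2 := congrArg (fun z => b⁻¹ • z) h1
      simp only [smul_smul, inv_mul_cancel₀ hb, one_smul, smul_neg] at h2
      exact h2
    refine Submodule.mem_map.mpr ⟨θm, Submodule.mem_inf.mpr ⟨hm, ?_⟩, ?_⟩
    · rw [LinearMap.mem_ker, schurOpM_apply]
      rw [hθp, map_neg, map_smul] at hY0
      -- hY0 : a • θm + -(b⁻¹ • ψ₊ψ₋ θm) = 0
      have h4 : a • θm = b⁻¹ • psiP K n q (psiM K n q θm) := add_neg_eq_zero.mp hY0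
      have h5 : psiP K n q (psiM K n q θm) = (a * b) • θm := by
        calc psiP K n q (psiM K n q θm) = b • (b⁻¹ • psiP K n q (psiM K n q θm)) := by
              rw [smul_smul, mul_inv_cancel₀ hb, one_smul]
          _ = b • (a • θm) := by rw [h4]
          _ = (a * b) • θm := by rw [smul_smul, mul_comm]
      rw [h5, sub_self]
    · rw [JmapM_apply, hθp]
      abel
  · intro y hy
    obtain ⟨θm, hθm, rfl⟩ := Submodule.mem_map.mp hy
    obtain ⟨hm, hk⟩ := Submodule.mem_inf.mp hθm
    rw [LinearMap.mem_ker, schurOpM_apply, sub_eq_zero] at hk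
    have hp : -(b⁻¹ • psiM K n q θm) ∈ Hom K (In (n + n)) (Gm (n + n) n) n :=
      Submodule.neg_mem _ (Submodule.smul_mem _ _ (psiM_mem K q hm))
    have hJ : JmapM K n q b θm = θm + -(b⁻¹ • psiM K n q θm) := by rw [JmapM_apply]; abel
    refine Submodule.mem_inf.mpr ⟨?_, ?_⟩
    · rw [hJ]
      exact Submodule.add_mem _ (Hom_Dm_le_Em K n n hm) (Hom_Gm_le_Em K n n hp)
    · have hk' : b⁻¹ • psiP K n q (psiM K n q θm) = a • θm := by
        rw [hk, smul_smul, mul_comm a b, ← mul_assoc, inv_mul_cancel₀ hb, one_mul]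
      have e1 : psiM K n q θm + b • (-(b⁻¹ • psiM K n q θm)) = 0 := by
        rw [smul_neg, smul_smul, mul_inv_cancel₀ hb, one_smul, add_neg_cancel]
      have e2 : a • θm + psiP K n q (-(b⁻¹ • psiM K n q θm)) = 0 := by
        rw [map_neg, map_smul, hk', add_neg_cancel]
      rw [LinearMap.mem_ker, LinearMap.mulRight_apply, hJ, ends_mul_vW K hn q a b hm hp, e1, e2, zero_mul,
        zero_mul, add_zero]

/-- for `b ≠ 0`: `dim(Ends ⊓ ker(∧v)) = dim(E₋ ⊓ ker(ψ₊ψ₋ − ab))` (`J′` is injective on `E₋`, since `E₋ ⊓ E₊ = ⊥`). -/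
theorem finrank_ends_ker_mirror (hn : 1 ≤ n) (q : ℕ → K) (a : K) {b : K} (hb : b ≠ 0) :
    Module.finrank K ↥(Em K (n + n) n n ⊓ LinearMap.ker (LinearMap.mulRight K (vW K (n + n) n q a b))) =
      Module.finrank K ↥(Hom K (In (n + n)) (Dm (n + n) n) n ⊓ LinearMap.ker (schurOpM K n q a b)) := by
  rw [ends_ker_eq_mirror K hn q a hb]
  refine finrank_map_of_injOn K (JmapM K n q b) _ fun x hx h0 => ?_
  have hxE : x ∈ Hom K (In (n + n)) (Dm (n + n) n) n := hx.1
  rw [JmapM_apply, sub_eq_zero] at h0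
  have h1 : x ∈ Hom K (In (n + n)) (Gm (n + n) n) n := by
    rw [h0]; exact Submodule.smul_mem _ _ (psiM_mem K q hxE)
  have : x ∈ Hom K (In (n + n)) (Dm (n + n) n) n ⊓ Hom K (In (n + n)) (Gm (n + n) n) n := ⟨hxE, h1⟩
  rw [EM_inf_EP K hn] at this
  exact (Submodule.mem_bot K).mp this

/-- **W-PURITY IN MIRRORED SCHUR FORM (b ≠ 0, every a — in particular the one-sided case a = 0).**
`finrank range(∧v ∣ HTⁿ) + 2ρ + dim(E₋ ⊓ ker(ψ₊ψ₋ − ab)) = C(2n,n)ρ + 2C(2n,n)`. -/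
theorem weilPurity_schur_mirror (hn : 1 ≤ n) (q : ℕ → K) (a : K) {b : K} (hb : b ≠ 0) :
    Module.finrank K (LinearMap.range (wedge K (n + n) n (vW K (n + n) n q a b))) +
        2 * (hankel1 K (n + n) n q).rank +
        Module.finrank K ↥(Hom K (In (n + n)) (Dm (n + n) n) n ⊓ LinearMap.ker (schurOpM K n q a b)) =
      (n + n).choose n * (hankel1 K (n + n) n q).rank + ((n + n).choose n + (n + n).choose n) := by
  have h1 := weilPurity_structure K hn q a b
  have h2 := finrank_eq_map_add_inf_ker K (Em K (n + n) n n) (LinearMap.mulRight K (vW K (n + n) n q a b))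
  rw [finrank_Em_nn K hn, finrank_ends_ker_mirror K hn q a hb] at h2
  omega

end SchurMirror

end Summit.Ventures.HSemireg.Wedge.Weil
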